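import Literature.AlgebraicGeometry.Frobenioids.PerfFactorialWeak
import Literature.AnabelianGeometry.EtaleTheta.FrdIVocabulary

/-!
# Merge pass, weak variant: the [FrdI] monoid vocabulary of [EtTh] §§3–4 with *weakly* perf-factorial
# monoids ([FrdI] Def. 2.4 (i) with (d) replaced by (d_ord) + (d_res))

`DivisorMonoids.lean` / `TemperedFrobenioid.lean` (abc-iut-L2-t3) type [EtTh] §3 over the hypothesis
structure `FrdIMonoidStub` ("perf-factorial", "realification", "`ℝ` supports", "non-dilating"), and
`FrdIVocabulary.lean` records the CANONICAL instantiation `treeMonoidVocab` (perf-factorial :=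
`Frobenioids.IsPerfFactorial`, [FrdI] Def. 2.4 (i) as printed).  Cell finding F-L2d2-1 (abc-iut-L2-d2;
lit register E-14; kernel witness `PerfFactorialProductCounterexample.not_isPerfFactorial_multiplicative_pi_nat`,
p413961): for a connected tempered covering `Y` whose `Δ^fil`-closures have INFINITELY MANY special-fibre
components (e.g. `Ÿ`, `Z_∞`), `Φ₀(Y^log) ⊇ ∏_j ℤ_{≥0}` fails condition (d) of Def. 2.4 (i) — so
[EtTh] Prop. 3.4 (i) "`Φ₀(Y^log)` is perf-factorial" (typed as the field
`DivisorMonoids.Prop34.isPerfFactorial` over the abstract vocabulary `V`) is false AS PRINTED at such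
objects for `V = treeMonoidVocab`.  The §3 typings are vocabulary-parametric (owner ruling, gen 2,
2026-08-26T00:07Z), so nothing there changes; what the §2–§4 arguments of [FrdI] actually use is the
named weakening `Frobenioids.IsPerfFactorialWeak` = (a)(b)(c) + (d_ord) + (d_res) (abc-iut-L1-t2,
`PerfFactorialWeak.lean`, with the same realification vocabulary `Rlf` / `toRealification`).  THIS FILE
records the corresponding instantiation of the stub, `treeMonoidVocabWeak`, so that every statement of
`DivisorMonoids.lean`, `TemperedFrobenioid*.lean`, `BiKummer*.lean` can be READ with the weak notion at
the objects where the printed one fails (ERRATUM note for `DivisorMonoids.Prop34` (i): read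
`V.IsPerfFactorial` as `IsPerfFactorialCof` there).  Cell finding F-L2d2-2 (abc-iut-L2-d2, 2026-08-26;
L2-lead ruling 02:44Z): (d_ord) + (d_res) ALONE are too weak for [EtTh] Lemma 3.5 (i) — for `P :=`
bounded functions `ℕ → ℤ_{≥0}` the printed step "for every `a ∈ P^rlf`, there exists an `a′ ∈ P^pf` such
that `a′ ≥ a`" (p.75) fails and with it the existence half of Lemma 3.5 (i) — so the vocabulary's
"perf-factorial" is `IsPerfFactorialCof` := weakly perf-factorial AND `M^pf` cofinal in `M^rlf`
(Mochizuki's sentence as the named clause (d_cof); printed (d) ⇒ (d_cof), e.g. `RlfCoord.exists_gauge`;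
`∏_J ℤ_{≥0}` satisfies it, abc-iut-L2-d2 `PiNat.rlf_cofinal`), never `IsPerfFactorialWeak` alone.
Additive: `FrdIVocabulary.lean` and `DivisorMonoids.lean` are untouched (no rebuild of their importers).
Statements only (v2 = v1 of p418418 with this one change, R2 of F-L2d2-2).
Source of the notions: [MochizukiFrdI2008] Def. 2.4 (i)–(ii) pp.47–48; use: [MochizukiEtTh2009] Prop 3.4
p.74, Def 3.6 p.76.  HONEST FRAMING: a vocabulary record; nothing of [EtTh] is asserted; nothing here
bears on [IUTchIII] Cor. 3.12.
-/

namespace Literature.AnabelianGeometry.EtaleTheta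

open CategoryTheory Opposite Literature.AlgebraicGeometry.Frobenioids

universe w

/-- The weak reading of "`ι : M → N` exhibits `N` as the realification `M^rlf`" ([FrdI] Def. 2.4 (i),
kurims p.48): `M` is WEAKLY perf-factorial and `N` is isomorphic to `M^rlf = h.Rlf`
(`Frobenioids.IsPerfFactorialWeak.Rlf`, same construction as `IsPerfFactorial.Rlf`) compatibly with
`M → M^pf → M^rlf`. [cite: MochizukiFrdI2008, Def. 2.4(i) p.48] -/
def IsRealificationViaWeak (M N : Type w) [CommMonoid M] [CommMonoid N] (ι : M →* N) : Prop :=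
  ∃ (h : IsPerfFactorialWeak M) (e : N ≃* h.Rlf),
    ∀ m : M, e (ι m) = h.toRealification (Perfection.of M m)

/-- (d_cof) "for every `a ∈ M^rlf`, there exists an `a′ ∈ M^pf` such that `a′ ≥ a`" ([EtTh] proof of
Lemma 3.5, p.75; a consequence of [FrdI] Def. 2.4 (i)(d)): `M^pf` is COFINAL in `M^rlf` for the
divisibility order — for a weakly perf-factorial `M` (same `Rlf`, `toRealification` as in
`PerfFactorialWeak.lean`). [cite: MochizukiEtTh2009, Lem 3.5 p.75] -/
def RlfCofinal {M : Type w} [CommMonoid M] (h : IsPerfFactorialWeak M) : Prop :=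
  ∀ x : h.Rlf, ∃ b : Perfection M, x ∣ h.toRealification b

/-- **Weakly perf-factorial with cofinal perfection**: (a)(b)(c) of [FrdI] Def. 2.4 (i) + (d_ord) + (d_res)
(`Frobenioids.IsPerfFactorialWeak`) + (d_cof) (`RlfCofinal`) — the consequences of the printed (d) that
[FrdI] §2–§4 AND [EtTh] Lemma 3.5 actually use (F-L2d2-1, F-L2d2-2).  Printed perf-factorial ⇒ this;
`∏_J ℤ_{≥0}` (the shape of `Φ₀` at `Ÿ`, `Z_∞`) satisfies it. [cite: MochizukiFrdI2008, Def. 2.4(i) p.47] -/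
def IsPerfFactorialCof (M : Type w) [CommMonoid M] : Prop :=
  ∃ h : IsPerfFactorialWeak M, RlfCofinal h

/-- **The weak canonical `FrdIMonoidStub`**: perf-factorial := `IsPerfFactorialCof` (weakly perf-factorial
with cofinal perfection — NOT `IsPerfFactorialWeak` alone, F-L2d2-2), realification :=
`IsRealificationViaWeak`; "`ℝ` supports" and "non-dilating" as in `treeMonoidVocab`.  Use: reading
[EtTh] Prop. 3.4 (i) / Def. 3.6 (ii) / Lemma 3.5 at tempered coverings with infinitely many special-fibre
components (F-L2d2-1). [cite: MochizukiEtTh2009, Prop 3.4 p.74] -/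
def treeMonoidVocabWeak : FrdIMonoidStub.{w} where
  IsPerfFactorial M _ := IsPerfFactorialCof M
  IsRealification M N _ _ ι := IsRealificationViaWeak M N ι
  RSupports M _ := Supports M .R
  IsNonDilating _ _ α := IsNonDilating α

/-- `treeMonoidVocabWeak.IsPerfFactorial` is `IsPerfFactorialCof` (weak + (d_cof)).
[cite: MochizukiEtTh2009, Prop 3.4 p.74] -/
theorem treeMonoidVocabWeak_isPerfFactorial (M : Type w) [CommMonoid M] :
    treeMonoidVocabWeak.IsPerfFactorial M ↔ IsPerfFactorialCof M := Iff.rfl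

/-- `treeMonoidVocabWeak.IsRealification` is `IsRealificationViaWeak`. [cite: MochizukiEtTh2009, Def 3.6 p.76] -/
theorem treeMonoidVocabWeak_isRealification (M N : Type w) [CommMonoid M] [CommMonoid N]
    (ι : M →* N) : treeMonoidVocabWeak.IsRealification M N ι ↔ IsRealificationViaWeak M N ι := Iff.rfl

/-- `treeMonoidVocabWeak.RSupports` is the tree's `Supports _ ℝ` (unchanged). [cite: MochizukiEtTh2009, Lem 3.5 p.75] -/
theorem treeMonoidVocabWeak_rSupports (M : Type w) [CommMonoid M] :
    treeMonoidVocabWeak.RSupports M ↔ Supports M .R := Iff.rfl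

/-- `treeMonoidVocabWeak.IsNonDilating` is the tree's `IsNonDilating` (unchanged).
[cite: MochizukiEtTh2009, Prop 3.4 p.74] -/
theorem treeMonoidVocabWeak_isNonDilating (M : Type w) [CommMonoid M] (α : M →* M) :
    treeMonoidVocabWeak.IsNonDilating M α ↔ IsNonDilating α := Iff.rfl

end Literature.AnabelianGeometry.EtaleTheta
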